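import Summits.CriticalPhenomena.Ising3DConformalLimit.Theses.PerfectScreening
import Summits.CriticalPhenomena.Ising3DConformalLimit.Theses.LeeYangGap

/-!
# Sketch (crux-ideate k = 2, gen 2): zero counting by the critical isotherm

Idea card `isotherm-zero-count-closes-gap` for crux `CoulombImpliesNontrivial`
(stmt-CriticalPhenomena-13885, route PerfectScreening r3).

LEVER. For the critical block spin `M_L = Σ_{x ∈ box 3 L} σ_x` in the infinite-volume state
`⟨·⟩ = plusExpect 3 β_c 0`, Lee–Yang gives `⟨e^{z M_L}⟩ = Π_j (1 + z²/t_j²)` (zeros `± i t_j`), hence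
(a) `Σ_L := ⟨M_L²⟩ = 2 Σ_j t_j⁻²` and (b) `⟨M_L⟩_{tilt s} := ⟨M_L e^{s M_L}⟩/⟨e^{s M_L}⟩ = Σ_j 2s/(t_j²+s²)
 ≥ N_L(s)/s`, `N_L(s) = #{j : t_j ≤ s}`; GKS II (block field ≤ global field) bounds the tilted block
magnetisation by `|box| · m(β_c, h)` (`s = β_c h` in the tree's field convention). So the zero-counting
function of the critical block is bounded by the CRITICAL ISOTHERM: `N_L(β_c h) ≤ β_c h (2L+1)³ m(β_c,h)`.
Under the crux's Coulomb antecedent `Σ_L ≥ c L⁵`, and (a) integrated by parts against this bound forces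
the FIRST zero down to `t₁(L) ≤ C L^{-2δ/(δ-1)}`, which is the fluctuation scale `L^{-5/2}` iff
`δ ≤ 5` = the Buckingham–Gunton value `(d+2-η)/(d-2+η)` at `η = 0`. Newman's bound
`12 t₁⁻⁴ ≤ 3Σ_L² - ⟨M_L⁴⟩` then gives `liminf g_L ≥ 12/C² > 0`, and a Gaussian pointwise limit would force
`g_L → 0` (route LeeYangGap support `GaussianLimitKillsBlockCoupling`, scale covariance being supplied
under Coulomb by `Disproof.canonical_of_coulomb`, restated here as `CanonicalOfCoulomb`). Residual crux: `UpperCriticalIsotherm` (δ ≤ 5 with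
amplitude), TRUE in the real model (δ ≈ 4.79) and pinned from below under Coulomb by Fisher's
inequality (`FisherUnderCoulomb`, 3 lines: Griffiths II + GHS concavity).
-/

noncomputable section

namespace Summit.CriticalPhenomena.Ising3DConformalLimit.Cruxes.CoulombImpliesNontrivial.IsothermZeroCount

open Literature.Probability.LatticeModels Filter Set
open scoped Topology BigOperators

/-- The crux, by name. -/
abbrev Crux : Prop :=
  Summit.CriticalPhenomena.Ising3DConformalLimit.Theses.PerfectScreening.CoulombImpliesNontrivial

/-- The antecedent (same decl text as `Disproof.Coulomb`). -/
def Coulomb : Prop :=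
  ∃ c : ℝ, 0 < c ∧ ∀ x : Site 3, x ≠ 0 → c / ‖x‖ ≤ criticalTwoPoint 3 x

/-- `Disproof.canonical_of_coulomb` (crux file `Cruxes/CoulombImpliesNontrivial/Disproof.lean`, §4.1), first
component, restated as a Prop so that this file does not import the (frequently rewritten) Disproof module:
under Coulomb every non-degenerate pointwise limit is scale covariant with `Δ = 1/2` on non-coincident
configurations. It is a THEOREM there (sorry-free); here it enters `crux_of` as the hypothesis `hcanon`. -/
def CanonicalOfCoulomb : Prop :=
  Coulomb → ∀ (ρ : ℝ → ℝ) (S : CorrFamily 3), (∀ δ ∈ Set.Ioc (0:ℝ) 1, 0 < ρ δ) →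
    HasPointwiseScalingLimit (criticalCorr 3) ρ S → IsNondegenerateTwoPoint S →
    ∀ (n : ℕ) (c : ℝ), 0 < c → ∀ x ∈ NonCoincident 3 n,
      S n (fun i => c • x i) = c ^ (-(n : ℝ) * (1/2)) * S n x

/-- RESIDUAL CRUX `UpperCriticalIsotherm` ("δ ≤ 5 with amplitude", the Buckingham–Gunton value at
`η = 0`): `m(β_c(3), h) ≤ A h^{1/5}` for small `h > 0` (tree field convention: weight
`exp(β Σ σσ + β h Σ σ)`, so only the constant differs from the physical-field statement). -/
def UpperCriticalIsotherm : Prop :=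
  ∃ A h₀ : ℝ, 0 < h₀ ∧ ∀ h : ℝ, 0 < h → h ≤ h₀ →
    magnetizationInField 3 (criticalBeta 3) h ≤ A * h ^ ((1:ℝ) / 5)

/-- FIRST LEMMA (provable now, GKS II: the magnetisation of the block under a field switched on
inside the block only is at most the magnetisation under the same field everywhere, site by site).
Written with un-normalised tilted expectations so that no division occurs. -/
def BlockFieldDomination : Prop :=
  ∀ (L : ℕ) (h : ℝ), 0 ≤ h →
    plusExpect 3 (criticalBeta 3) 0
        (fun σ => (∑ x ∈ box 3 L, spinAt x σ) *
          Real.exp (criticalBeta 3 * h * ∑ x ∈ box 3 L, spinAt x σ))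
      ≤ (2 * L + 1) ^ 3 * magnetizationInField 3 (criticalBeta 3) h *
        plusExpect 3 (criticalBeta 3) 0
          (fun σ => Real.exp (criticalBeta 3 * h * ∑ x ∈ box 3 L, spinAt x σ))

/-- ZERO COUNTING BY THE ISOTHERM (Lee–Yang product form + `BlockFieldDomination`): the number of
(distinct) Lee–Yang zeros `θ ∈ (0, β_c h]` of the critical block characteristic function
`θ ↦ ⟨cos(θ M_L)⟩_{β_c}` is at most `β_c h · (2L+1)³ · m(β_c, h)`. (The multiplicity version is what
`IsothermForcesGap` uses internally.) -/
def ZeroCountingByIsotherm : Prop :=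
  ∀ (L : ℕ) (h : ℝ), 0 < h → ∀ Z : Finset ℝ,
    (∀ θ ∈ Z, 0 < θ ∧ θ ≤ criticalBeta 3 * h ∧
      plusExpect 3 (criticalBeta 3) 0
        (fun σ => Real.cos (θ * ∑ x ∈ box 3 L, spinAt x σ)) = 0) →
    (Z.card : ℝ) ≤ criticalBeta 3 * h * (2 * L + 1) ^ 3 * magnetizationInField 3 (criticalBeta 3) h

/-- The conclusion "a Lee–Yang zero of the critical block at the fluctuation scale, for all large L":
route LeeYangGap's crux (GAP) at `β = β_c`, eventually rather than frequently in `L`. -/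
def GapAtCriticality : Prop :=
  ∃ C : ℝ, ∃ L₀ : ℕ, ∀ L : ℕ, L₀ ≤ L → ∃ θ : ℝ, 0 < θ ∧
    θ ^ 2 * plusExpect 3 (criticalBeta 3) 0 (fun σ => (∑ x ∈ box 3 L, spinAt x σ) ^ 2) ≤ C ∧
    plusExpect 3 (criticalBeta 3) 0 (fun σ => Real.cos (θ * ∑ x ∈ box 3 L, spinAt x σ)) = 0

/-- K3 (provable now GIVEN the two inputs; size M–L): Coulomb variance `Σ_L ≥ c' L⁵`, the identity
`Σ_L = 2Σ_j t_j⁻² = 4∫ t⁻³ N_L(t) dt`, and zero counting `N_L(t) ≤ t (2L+1)³ m(β_c, t/β_c)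
≤ A' (2L+1)³ t^{6/5}` give `c' L⁵ ≤ 5A'(2L+1)³ t₁^{-4/5} + O(L³)`, i.e. `t₁ ≤ C L^{-5/2}`, and
`t₁² Σ_L ≤ C² · C_IR` by the infrared bound `Σ_L ≤ C_IR L⁵`. -/
def IsothermForcesGap : Prop :=
  Coulomb → UpperCriticalIsotherm → GapAtCriticality

/-- COMPANION (provable now, S): Fisher's inequality `δ ≥ (d+2-η)/(d-2+η) = 5` in amplitude form
under Coulomb — `m² ≥ ⟨σ₀σ_x⟩_0 - ⟨σ₀;σ_x⟩_h` (Griffiths II), so `⟨σ₀;σ_x⟩_h ≥ c/(2‖x‖)` for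
`‖x‖ ≤ c/(2m²)`, whence `χ(h) ≥ c₃ m⁻⁴`; GHS concavity gives `χ ≤ m/h`; so `m⁵ ≥ c₃ h`. It shows the
residual is SHARP under the antecedent, and that any strict improvement `m = o(h^{1/5})` proves
`NonSaturation` (item 1342), i.e. refutes the antecedent. -/
def FisherUnderCoulomb : Prop :=
  Coulomb → ∃ c h₀ : ℝ, 0 < c ∧ 0 < h₀ ∧ ∀ h : ℝ, 0 < h → h ≤ h₀ →
    c * h ^ ((1:ℝ) / 5) ≤ magnetizationInField 3 (criticalBeta 3) h

/-- Route LeeYangGap's transfer support, with scale covariance asked only on non-coincident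
configurations (which is all `Disproof.canonical_of_coulomb` supplies; the route's version follows by
replacing `S` with its restriction `S·1_{NonCoincident}`, which has the same limit, non-degeneracy and
`U₄`). -/
def GaussianLimitKillsBlockCouplingNC : Prop :=
  ∀ (ρ : ℝ → ℝ) (Δ : ℝ) (S : CorrFamily 3), (∀ δ ∈ Set.Ioc (0:ℝ) 1, 0 < ρ δ) →
    HasPointwiseScalingLimit (criticalCorr 3) ρ S → IsNondegenerateTwoPoint S →
    (∀ (n : ℕ) (c : ℝ), 0 < c → ∀ x ∈ NonCoincident 3 n,
        S n (fun i => c • x i) = c ^ (-(n : ℝ) * Δ) * S n x) →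
    ¬ HasNontrivialU4 S →
    Tendsto (fun L : ℕ =>
      (3 * (plusExpect 3 (criticalBeta 3) 0 (fun σ => (∑ x ∈ box 3 L, spinAt x σ) ^ 2)) ^ 2 -
          plusExpect 3 (criticalBeta 3) 0 (fun σ => (∑ x ∈ box 3 L, spinAt x σ) ^ 4)) /
        (plusExpect 3 (criticalBeta 3) 0 (fun σ => (∑ x ∈ box 3 L, spinAt x σ) ^ 2)) ^ 2)
      atTop (𝓝 0)

/-- FREE COROLLARY of the lever with the trivial isotherm bound `m ≤ 1` (provable now, S, Lee–Yang + Newman only):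
`t₁(L) ≤ 4|B_L|/Σ_L`, hence the block Binder coupling has the polynomial floor
`g_L = (3Σ_L² - ⟨M_L⁴⟩)/Σ_L² ≥ (3/64)·(Σ_L/|B_L|²)²` for every `L` (under Coulomb `≳ L⁻²`; unconditionally `≳ L⁻⁴`). -/
def BinderFloor : Prop :=
  ∀ L : ℕ,
    (3 / 64 : ℝ) * (plusExpect 3 (criticalBeta 3) 0 (fun σ => (∑ x ∈ box 3 L, spinAt x σ) ^ 2) /
        ((2 * (L : ℝ) + 1) ^ 3) ^ 2) ^ 2 ≤
      (3 * (plusExpect 3 (criticalBeta 3) 0 (fun σ => (∑ x ∈ box 3 L, spinAt x σ) ^ 2)) ^ 2 -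
          plusExpect 3 (criticalBeta 3) 0 (fun σ => (∑ x ∈ box 3 L, spinAt x σ) ^ 4)) /
        (plusExpect 3 (criticalBeta 3) 0 (fun σ => (∑ x ∈ box 3 L, spinAt x σ) ^ 2)) ^ 2

/-! ## The residual's own reduction (magnetic sector, all at `β = β_c(3)`) -/

/-- The truncated two-point function in a field, `⟨σ₀;σ_x⟩_{β_c,h} = ⟨σ₀σ_x⟩_{β_c,h} - m(β_c,h)²`. -/
def truncTwoPointInField (h : ℝ) (x : Site 3) : ℝ :=
  plusExpect 3 (criticalBeta 3) h (spinPair 0 x) - magnetizationInField 3 (criticalBeta 3) h ^ 2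

/-- SUB-RESIDUAL `SusceptibilityVsMagnetisation` ("χ(h) ≤ C·m(h)⁻⁴", equivalently: the field correlation
length is at most the magnetisation scale `ℓ_m = m⁻²`; exponent form `ν_c ≤ 2/δ`, true in the real model
(0.403 ≤ 0.418) and in mean field, false exactly in the `η = 0` Gaussian world). With `dm/dh = χ` it integrates
to `m⁵ ≤ 5C h`, i.e. `UpperCriticalIsotherm` (`upperIsotherm_of_susceptibility`, stated as an implication to be
proved with the tree's field-derivative facts). -/
def SusceptibilityVsMagnetisation : Prop :=
  ∃ C h₀ : ℝ, 0 < h₀ ∧ ∀ h : ℝ, 0 < h → h ≤ h₀ →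
    Summable (fun x : Site 3 => truncTwoPointInField h x) ∧
    (∑' x : Site 3, truncTwoPointInField h x) * magnetizationInField 3 (criticalBeta 3) h ^ 4 ≤ C

/-- The integration step `χ ≤ C m⁻⁴ ⇒ m ≤ (5C h)^{1/5}` as a filed implication (needs: `h ↦ m(β_c,h)` is
differentiable on `(0,h₀)` with derivative `χ(h) = Σ_x ⟨σ₀;σ_x⟩_h`, continuous at `0` with `m(β_c,0) = 0`). -/
def UpperIsothermOfSusceptibility : Prop :=
  SusceptibilityVsMagnetisation → UpperCriticalIsotherm

/-! ## Checked compositions -/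

/-- `GapAtCriticality` is route LeeYangGap's crux `NearCriticalLeeYangGap` (with `β = β_c`). -/
theorem nearCriticalLeeYangGap_of_gap (h : GapAtCriticality) :
    Summit.CriticalPhenomena.Ising3DConformalLimit.Theses.LeeYangGap.NearCriticalLeeYangGap := by
  obtain ⟨C, L₀, hL⟩ := h
  refine ⟨C, (Filter.eventually_atTop.2 ⟨L₀, fun L hL' => ?_⟩).frequently⟩
  obtain ⟨θ, hθ, h1, h2⟩ := hL L hL'
  exact ⟨criticalBeta 3, θ, criticalBeta_nonneg 3, le_rfl, hθ, h1, h2⟩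

/-- A zero at the fluctuation scale + Newman's identity give a block Binder coupling `≥ 12/C²`. -/
theorem blockCoupling_ge {C θ V K : ℝ} (hθ : 0 < θ) (hV : 0 < V) (hθC : θ ^ 2 * V ≤ C)
    (hK : 12 / θ ^ 4 ≤ K) : 12 / C ^ 2 ≤ K / V ^ 2 := by
  have hx : 0 < θ ^ 2 * V := by positivity
  have hC : 0 ≤ C := hx.le.trans hθC
  have h1 : (θ ^ 2 * V) ^ 2 ≤ C ^ 2 := by
    nlinarith [mul_nonneg (sub_nonneg.2 hθC) (add_nonneg hC hx.le)]
  have h2 : 12 / C ^ 2 ≤ 12 / (θ ^ 2 * V) ^ 2 :=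
    div_le_div_of_nonneg_left (by norm_num) (by positivity) h1
  have h3 : (12 / θ ^ 4) / V ^ 2 = 12 / (θ ^ 2 * V) ^ 2 := by
    rw [div_div]
    congr 1
    ring
  have h4 : (12 / θ ^ 4) / V ^ 2 ≤ K / V ^ 2 := div_le_div_of_nonneg_right hK (by positivity)
  rw [← h3] at h2
  exact h2.trans h4

/-- THE LINE CONCLUDES THE CRUX BY NAME: `IsothermForcesGap` + the residual `UpperCriticalIsotherm`
+ Newman's first-zero bound (route LeeYangGap support, known) + the Gaussian-limit transfer
(route LeeYangGap support, NC form) + positivity of the block variance ⇒ `CoulombImpliesNontrivial`.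
Scale covariance of ANY non-degenerate limit under Coulomb is `Disproof.canonical_of_coulomb` (= `hcanon`). -/
theorem crux_of (hgap : IsothermForcesGap) (hiso : UpperCriticalIsotherm)
    (hN : Summit.CriticalPhenomena.Ising3DConformalLimit.Theses.LeeYangGap.NewmanFirstZeroBound)
    (hkill : GaussianLimitKillsBlockCouplingNC) (hcanon : CanonicalOfCoulomb)
    (hVpos : ∀ L : ℕ, 0 < plusExpect 3 (criticalBeta 3) 0 (fun σ => (∑ x ∈ box 3 L, spinAt x σ) ^ 2)) :
    Crux := by
  intro hC ρ S hρ hlim hnd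
  by_contra hU4
  have hcov := hcanon hC ρ S hρ hlim hnd
  have htend := hkill ρ (1/2) S hρ hlim hnd hcov hU4
  obtain ⟨C, L₀, hL⟩ := hgap hC hiso
  -- C > 0: at L₀ there is a zero θ > 0 with θ²Σ ≤ C and Σ > 0
  have hCpos : 0 < C := by
    obtain ⟨θ, hθ, h1, -⟩ := hL L₀ le_rfl
    exact lt_of_lt_of_le (mul_pos (pow_pos hθ 2) (hVpos L₀)) h1
  have hev := htend.eventually (gt_mem_nhds (show (0:ℝ) < 12 / C ^ 2 by positivity))
  obtain ⟨L₁, hL₁⟩ := Filter.eventually_atTop.1 hev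
  set L := max L₀ L₁ with hLdef
  obtain ⟨θ, hθ, h1, h2⟩ := hL L (le_max_left _ _)
  have hNew := hN L θ hθ h2
  have hge := blockCoupling_ge hθ (hVpos L) h1 hNew
  have hlt := hL₁ L (le_max_right _ _)
  exact absurd hge (not_le.2 hlt)

end Summit.CriticalPhenomena.Ising3DConformalLimit.Cruxes.CoulombImpliesNontrivial.IsothermZeroCount

end
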